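import Summits.QuantumFields.YangMills.Theorems.IR.SiteRPGeometry

/-!
# Site-hyperplane reflection positivity, file 2∕4: the half-weighted Boltzmann factor and the Schwarz DOUBLING inequality on the torus

Landed for item `stmt-QuantumFields-19354` (`--supports … --as helper`) by the LEAD prover ab-p1 under director-ym RULING g9-№2 ∕ №14 (3)
(critic ym-ir-crit-2 03:04:13Z ∕ 03:14:37Z: PASS as supplier); authored by ideator ym-ir-idea-5 g7, split of the sorry-free workfile
`Cruxes/IR/Lines/pressure_monotone_tm.lean` v5 (Part B = `Cruxes/IR/Lines/rp_doubling.lean`) per `Cruxes/IR/Lines/pressure_monotone_tm_LANDING.md`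
(eight files: `SiteRPGeometry` → `SiteRPDoubling` → `SiteRPZdBoxes` → `SiteRPFreeCubeDoubling`; `PressureMonotoneTMFloor` → `…LinearFloor` → `…LogFloor` → `…Equipartition`).

Content (§3 of Part B): `Touches`∕`IsUpper`∕`IsFace`, `tw`, `halfWeight`, `halfWeight_mul_halfWeight_configReflect`, `sq_integral_halfWeight_le`,
★ `sq_integral_prod_tw_le` (Schwarz doubling for upper plaquette sets, product Haar measure; via `LatticeRP.re_sum_pair_sq_le`).

HONESTY.  Supplier ∕ kinematic content only (holds for `U(1)` too): nothing here proves the Yang–Mills mass gap (Clay), `BalabanLadder.IR`,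
`BalabanLadder.NT` or a lattice gap; R4 closes only the conditional finite-𝕋⁴ rung `BalabanLadder.UV`.
-/

open MeasureTheory Finset Filter
open scoped ComplexConjugate

namespace Summit.QuantumFields.YangMills.Cruxes.IR.RPDoubling

open Literature.MathematicalPhysics.QuantumFieldTheory
open Literature.MathematicalPhysics.QuantumLattice

noncomputable section

/-! ## §3 The half-weighted Boltzmann factor and the doubling inequality on the torus -/

section TorusDoubling

open scoped Classical

variable {d L : ℕ} [NeZero L]

/-- The plaquette lies in a plane containing the direction `i`. -/
def Touches (i : Fin d) (p : Plaquette d L) : Prop := p.2.1.1 = i ∨ p.2.1.2 = i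

/-- UPPER plaquettes of range `H`: all links at heights `0 … H` (positive or in-plane). -/
def IsUpper (i : Fin d) (c : ZMod L) (H : ℕ) (p : Plaquette d L) : Prop :=
  (¬ Touches i p ∧ ht i c p.1 ≤ H) ∨ (Touches i p ∧ ht i c p.1 + 1 ≤ H)

/-- FACE plaquettes: those lying in the reflection plane (fixed by the reflection). -/
def IsFace (i : Fin d) (c : ZMod L) (p : Plaquette d L) : Prop := ¬ Touches i p ∧ ht i c p.1 = 0

omit [NeZero L] in
/-- A face plaquette (in the reflection plane, not touching direction `i`) is fixed by `plaqReflect i c`. -/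
theorem plaqReflect_of_isFace {i : Fin d} {c : ZMod L} {p : Plaquette d L} (hp : IsFace i c p) :
    plaqReflect i c p = p := by
  obtain ⟨x, jk⟩ := p
  obtain ⟨hnt, h0⟩ := hp
  unfold plaqReflect
  rw [if_neg (by exact hnt), siteReflect_eq_self_of_ht _ _ _ h0]

/-- The reflection of an upper non-face plaquette is not upper (it lies strictly below the plane). -/
theorem not_isUpper_plaqReflect {i : Fin d} {c : ZMod L} {H : ℕ} (hH : 2 * H < L) {p : Plaquette d L}
    (hp : IsUpper i c H p) (hnf : ¬ IsFace i c p) : ¬ IsUpper i c H (plaqReflect i c p) := by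
  obtain ⟨x, jk⟩ := p
  unfold IsUpper IsFace Touches plaqReflect at *
  simp only at hp hnf ⊢
  by_cases ht0 : jk.1.1 = i ∨ jk.1.2 = i
  · rw [if_pos ht0]
    have h1 : ht i c x + 1 ≤ H := by tauto
    rw [ht_siteReflect_sub_single i c x (by omega)]
    omega
  · rw [if_neg ht0]
    have h1 : ht i c x ≤ H := by tauto
    have h2 : ht i c x ≠ 0 := by tauto
    rw [ht_siteReflect i c x h2]
    omega

variable {G : Type*} [Group G]

/-- A link `(y, j)` with `j ≠ i` at height `≤ H` lies in `posEdges ∪ planeEdges`. -/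
theorem mem_PM_of_ne {i : Fin d} {c : ZMod L} {H : ℕ} {y : Site d L} {j : Fin d} (hj : j ≠ i)
    (hy : ht i c y ≤ H) : (y, j) ∈ posEdges i c H ∪ planeEdges i c := by
  rw [Finset.mem_union, mem_posEdges, mem_planeEdges]
  rcases Nat.eq_zero_or_pos (ht i c y) with h0 | h0
  · exact Or.inr ⟨hj, h0⟩
  · exact Or.inl (Or.inl ⟨hj, h0, hy⟩)

/-- A direction-`i` link `(y, i)` with `ht y + 1 ≤ H` lies in `posEdges ∪ planeEdges`. -/
theorem mem_PM_of_eq {i : Fin d} {c : ZMod L} {H : ℕ} {y : Site d L} (hy : ht i c y + 1 ≤ H) :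
    (y, i) ∈ posEdges i c H ∪ planeEdges i c := by
  rw [Finset.mem_union, mem_posEdges]
  exact Or.inl (Or.inr ⟨rfl, hy⟩)

/-- The holonomy of an upper plaquette depends only on the positive and in-plane links. -/
theorem plaquetteHolonomy_eq_of_isUpper {i : Fin d} {c : ZMod L} {H : ℕ} (hH : 2 * H < L)
    {p : Plaquette d L} (hp : IsUpper i c H p) {U V : GaugeConfig d L G}
    (hUV : ∀ e ∈ ((posEdges i c H ∪ ∅ ∪ planeEdges i c : Finset (Edge d L)) : Set (Edge d L)), U e = V e) :
    plaquetteHolonomy U p.1 p.2.1.1 p.2.1.2 = plaquetteHolonomy V p.1 p.2.1.1 p.2.1.2 := by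
  rw [Finset.union_empty] at hUV
  have hUV' : ∀ e ∈ posEdges i c H ∪ planeEdges i c, U e = V e := fun e he => hUV e (Finset.mem_coe.2 he)
  obtain ⟨x, ⟨⟨j, k⟩, hjk⟩⟩ := p
  unfold IsUpper Touches at hp
  simp only at hp ⊢
  simp only [plaquetteHolonomy]
  by_cases hj : j = i
  · subst hj
    have hk : k ≠ j := fun h => by simp [h] at hjk
    have h1 : ht j c x + 1 ≤ H := by tauto
    rw [hUV' _ (mem_PM_of_eq h1),
      hUV' _ (mem_PM_of_ne hk (by rw [ht_shift_self j c x (by omega)]; exact h1)),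
      hUV' _ (mem_PM_of_eq (by rw [ht_shift_ne j c x hk]; exact h1)),
      hUV' _ (mem_PM_of_ne hk (by omega))]
  · by_cases hk : k = i
    · subst hk
      have h1 : ht k c x + 1 ≤ H := by tauto
      rw [hUV' _ (mem_PM_of_ne hj (by omega)),
        hUV' _ (mem_PM_of_eq (by rw [ht_shift_ne k c x hj]; exact h1)),
        hUV' _ (mem_PM_of_ne hj (by rw [ht_shift_self k c x (by omega)]; exact h1)),
        hUV' _ (mem_PM_of_eq h1)]
    · have h1 : ht i c x ≤ H := by tauto
      rw [hUV' _ (mem_PM_of_ne hj h1),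
        hUV' _ (mem_PM_of_ne hk (by rw [ht_shift_ne i c x hj]; exact h1)),
        hUV' _ (mem_PM_of_ne hj (by rw [ht_shift_ne i c x hk]; exact h1)),
        hUV' _ (mem_PM_of_ne hk h1)]

variable {N : ℕ} [TopologicalSpace G] [IsTopologicalGroup G] [CompactSpace G] [MeasurableSpace G] [BorelSpace G]
variable (ρ : G →* Matrix (Fin N) (Fin N) ℂ) (β : ℝ)

/-- The torus Boltzmann weight of one plaquette. -/
def tw (p : Plaquette d L) (U : GaugeConfig d L G) : ℝ := Real.exp (-β * plaquetteCost ρ U p)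

/-- The HALF-WEIGHTED Boltzmann factor of a set of plaquettes: face plaquettes carry `w_p^{1/2}`. -/
def halfWeight (i : Fin d) (c : ZMod L) (A : Finset (Plaquette d L)) (U : GaugeConfig d L G) : ℝ :=
  ∏ p ∈ A, if IsFace i c p then Real.sqrt (tw ρ β p U) else tw ρ β p U

omit [NeZero L] [TopologicalSpace G] [IsTopologicalGroup G] [CompactSpace G] [MeasurableSpace G] [BorelSpace G] in
/-- The one-plaquette Boltzmann weight `tw = e^{−β s_p}` is positive. -/
theorem tw_pos [NeZero L] (p : Plaquette d L) (U : GaugeConfig d L G) : 0 < tw ρ β p U := Real.exp_pos _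

omit [NeZero L] [TopologicalSpace G] [IsTopologicalGroup G] [CompactSpace G] [MeasurableSpace G] [BorelSpace G] in
/-- `tw ≤ 1` for `β ≥ 0` (the plaquette cost is non-negative when `Re tr ρ ≤ N`). -/
theorem tw_le_one [NeZero L] (hρN : ∀ g, (ρ g).trace.re ≤ N) (hβ : 0 ≤ β) (p : Plaquette d L) (U : GaugeConfig d L G) :
    tw ρ β p U ≤ 1 := by
  unfold tw
  rw [Real.exp_le_one_iff]
  have : 0 ≤ plaquetteCost ρ U p := by
    unfold plaquetteCost; linarith [hρN (plaquetteHolonomy U p.1 p.2.1.1 p.2.1.2)]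
  nlinarith

omit [NeZero L] [CompactSpace G] [MeasurableSpace G] [BorelSpace G] in
/-- `U ↦ tw ρ β p U` is continuous (continuity of `ρ`). -/
theorem continuous_tw [NeZero L] (hρ : Continuous ρ) (p : Plaquette d L) :
    Continuous fun U : GaugeConfig d L G => tw ρ β p U := by
  unfold tw plaquetteCost
  have h1 : Continuous fun U : GaugeConfig d L G => plaquetteHolonomy U p.1 p.2.1.1 p.2.1.2 := by
    unfold plaquetteHolonomy; fun_prop
  have h2 : Continuous fun U : GaugeConfig d L G =>
      (ρ (plaquetteHolonomy U p.1 p.2.1.1 p.2.1.2)).trace.re :=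
    Complex.continuous_re.comp (hρ.comp h1).matrix_trace
  exact Real.continuous_exp.comp (continuous_const.mul (continuous_const.sub h2))

omit [CompactSpace G] [MeasurableSpace G] [BorelSpace G] in
/-- A finite product of one-plaquette weights is continuous in the configuration. -/
theorem continuous_prod_tw (hρ : Continuous ρ) (A : Finset (Plaquette d L)) :
    Continuous fun U : GaugeConfig d L G => ∏ p ∈ A, tw ρ β p U :=
  continuous_finsetProd _ fun p _ => continuous_tw ρ β hρ p

omit [CompactSpace G] [MeasurableSpace G] [BorelSpace G] in
/-- The half-weight `halfWeight ρ β i c A` is continuous in the configuration. -/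
theorem continuous_halfWeight (hρ : Continuous ρ) (i : Fin d) (c : ZMod L) (A : Finset (Plaquette d L)) :
    Continuous fun U : GaugeConfig d L G => halfWeight ρ β i c A U := by
  unfold halfWeight
  refine continuous_finsetProd _ fun p _ => ?_
  by_cases hf : IsFace i c p
  · simp only [hf, if_true]; exact (continuous_tw ρ β hρ p).sqrt
  · simp only [hf, if_false]; exact continuous_tw ρ β hρ p

omit [TopologicalSpace G] [IsTopologicalGroup G] [CompactSpace G] [MeasurableSpace G] [BorelSpace G] in
/-- `0 ≤ halfWeight`. -/
theorem halfWeight_nonneg (i : Fin d) (c : ZMod L) (A : Finset (Plaquette d L)) (U : GaugeConfig d L G) :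
    0 ≤ halfWeight ρ β i c A U := by
  unfold halfWeight
  refine prod_nonneg fun p _ => ?_
  by_cases hf : IsFace i c p
  · rw [if_pos hf]; exact Real.sqrt_nonneg _
  · rw [if_neg hf]; exact (tw_pos ρ β p U).le

omit [TopologicalSpace G] [IsTopologicalGroup G] [CompactSpace G] [MeasurableSpace G] [BorelSpace G] in
/-- `halfWeight ≤ 1` for `β ≥ 0` and `Re tr ρ ≤ N`. -/
theorem halfWeight_le_one (hρN : ∀ g, (ρ g).trace.re ≤ N) (hβ : 0 ≤ β) (i : Fin d) (c : ZMod L)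
    (A : Finset (Plaquette d L)) (U : GaugeConfig d L G) : halfWeight ρ β i c A U ≤ 1 := by
  unfold halfWeight
  refine prod_le_one (fun p _ => ?_) (fun p _ => ?_)
  · by_cases hf : IsFace i c p
    · rw [if_pos hf]; exact Real.sqrt_nonneg _
    · rw [if_neg hf]; exact (tw_pos ρ β p U).le
  · by_cases hf : IsFace i c p
    · rw [if_pos hf]; exact (Real.sqrt_le_sqrt (tw_le_one ρ β hρN hβ p U)).trans_eq Real.sqrt_one
    · rw [if_neg hf]; exact tw_le_one ρ β hρN hβ p U

omit [TopologicalSpace G] [IsTopologicalGroup G] [CompactSpace G] [MeasurableSpace G] [BorelSpace G] in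
/-- `∏_{p ∈ A} w_p ≤ halfWeight` (`w ≤ √w` on `[0, 1]`). -/
theorem prod_tw_le_halfWeight (hρN : ∀ g, (ρ g).trace.re ≤ N) (hβ : 0 ≤ β) (i : Fin d) (c : ZMod L)
    (A : Finset (Plaquette d L)) (U : GaugeConfig d L G) :
    ∏ p ∈ A, tw ρ β p U ≤ halfWeight ρ β i c A U := by
  unfold halfWeight
  refine prod_le_prod (fun p _ => (tw_pos ρ β p U).le) fun p _ => ?_
  by_cases hf : IsFace i c p
  · rw [if_pos hf]
    calc tw ρ β p U = Real.sqrt ((tw ρ β p U) ^ 2) := (Real.sqrt_sq (tw_pos ρ β p U).le).symm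
      _ ≤ Real.sqrt (tw ρ β p U) :=
          Real.sqrt_le_sqrt (by nlinarith [tw_pos ρ β p U, tw_le_one ρ β hρN hβ p U])
  · rw [if_neg hf]

omit [MeasurableSpace G] [BorelSpace G] in
/-- The weight of a reflected configuration is the weight of the reflected plaquette. -/
theorem tw_configReflect (hρ : Continuous ρ) (i : Fin d) (c : ZMod L) (p : Plaquette d L) (U : GaugeConfig d L G) :
    tw ρ β p (configReflect i c U) = tw ρ β (plaqReflect i c p) U := by
  unfold tw; rw [plaquetteCost_configReflect ρ hρ]

omit [MeasurableSpace G] [BorelSpace G] in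
/-- **`F · (F ∘ Θ)` is the full Boltzmann weight of the doubled set** `A ∪ θ(A ∖ faces)`. -/
theorem halfWeight_mul_halfWeight_configReflect (hρ : Continuous ρ) {i : Fin d} {c : ZMod L} {H : ℕ}
    (hH : 2 * H < L) {A : Finset (Plaquette d L)} (hA : ∀ p ∈ A, IsUpper i c H p) (U : GaugeConfig d L G) :
    halfWeight ρ β i c A U * halfWeight ρ β i c A (configReflect i c U) =
      ∏ p ∈ A ∪ (A.filter fun p => ¬ IsFace i c p).image (plaqReflect i c), tw ρ β p U := by
  have hdisj : Disjoint A ((A.filter fun p => ¬ IsFace i c p).image (plaqReflect i c)) := by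
    rw [Finset.disjoint_left]
    intro q hq hq'
    obtain ⟨p, hp, rfl⟩ := Finset.mem_image.1 hq'
    rw [Finset.mem_filter] at hp
    exact not_isUpper_plaqReflect hH (hA p hp.1) hp.2 (hA _ hq)
  rw [prod_union hdisj, prod_image fun p _ q _ h => plaqReflect_injective i c h, prod_filter,
    halfWeight, halfWeight, ← prod_mul_distrib, ← prod_mul_distrib]
  refine prod_congr rfl fun p _ => ?_
  by_cases hf : IsFace i c p
  · simp only [hf, not_true_eq_false, if_true, if_false, tw_configReflect ρ β hρ, plaqReflect_of_isFace hf,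
      mul_one]
    exact Real.mul_self_sqrt (tw_pos ρ β p U).le
  · simp only [hf, not_false_eq_true, if_true, if_false, tw_configReflect ρ β hρ]

variable [SecondCountableTopology G]

omit [NeZero L] in
/-- Splicing along the empty index set returns the first component: `LatticeRP.splice ∅ p = p.1`. -/
theorem splice_empty {ι X : Type*} [DecidableEq ι] (p : (ι → X) × (ι → X)) :
    LatticeRP.splice (∅ : Finset ι) p = p.1 := by
  funext j; simp [LatticeRP.splice_apply]

/-- **Reflection positivity through sites, Schwarz form**: `(∫ F)² ≤ ∫ F · (F ∘ Θ)` for the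
half-weighted Boltzmann factor of a set of upper plaquettes. -/
theorem sq_integral_halfWeight_le (hρ : Continuous ρ) (hρN : ∀ g, (ρ g).trace.re ≤ N) (hβ : 0 ≤ β)
    {i : Fin d} {c : ZMod L} {H : ℕ} (hH : 2 * H < L) {A : Finset (Plaquette d L)}
    (hA : ∀ p ∈ A, IsUpper i c H p) :
    (∫ U, halfWeight ρ β i c A U ∂(LatticeRP.piMeasure (haarProbability G))) ^ 2 ≤
      ∫ U, halfWeight ρ β i c A U * halfWeight ρ β i c A (configReflect i c U)
        ∂(LatticeRP.piMeasure (haarProbability G)) := by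
  set μ : Measure (GaugeConfig d L G) := LatticeRP.piMeasure (haarProbability G) with hμ
  set Φ : GaugeConfig d L G → ℂ := fun U => (halfWeight ρ β i c A U : ℂ) with hΦ
  have hΦm : Measurable Φ := (Complex.continuous_ofReal.comp (continuous_halfWeight ρ β hρ i c A)).measurable
  have hΦb : ∀ U, ‖Φ U‖ ≤ 1 := fun U => by
    rw [hΦ]; dsimp only
    rw [Complex.norm_real, Real.norm_of_nonneg (halfWeight_nonneg ρ β i c A U)]
    exact halfWeight_le_one ρ β hρN hβ i c A U
  have hΦdep : DependsOn Φ ((posEdges i c H ∪ ∅ ∪ planeEdges i c : Finset (Edge d L)) : Set (Edge d L)) := by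
    intro U V hUV
    rw [hΦ]; dsimp only
    congr 1
    unfold halfWeight
    refine prod_congr rfl fun p hp => ?_
    have h := plaquetteHolonomy_eq_of_isUpper (G := G) hH (hA p hp) hUV
    simp only [tw, plaquetteCost, h]
  have key := (LatticeRP.re_sum_pair_sq_le (haarProbability G) (∅ : Finset (Edge d L)) (configReflect i c)
    (I := Empty) (fun _ _ => (0 : ℂ)) (planeEdges i c) (posEdges i c H)
    (measurePreserving_configReflect i c) (fun U e he => configReflect_apply_of_mem_planeEdges i c U he)
    (fun e he => dependsOn_configReflect hH he) (disjoint_planeEdges_posEdges i c H)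
    (Finset.disjoint_empty_right _) (fun _ => measurable_const) (Ka := 0) (fun _ _ => by simp)
    (fun k => Empty.elim k) (κ := Unit) (Φ := fun _ => Φ) (Ψ := fun _ _ => (1 : ℂ))
    (fun _ => hΦm) (fun _ => measurable_const) (KΦ := 1) (KΨ := 1) (fun _ U => hΦb U)
    (fun _ _ => by simp) (fun _ => hΦdep) (fun _ _ _ _ => rfl)).2
  simp only [splice_empty, Finset.univ_unique, Finset.sum_singleton, Finset.univ_eq_empty,
    Finset.sum_empty, Complex.exp_zero, mul_one, map_one] at key
  rw [integral_fun_fst (fun U => Φ U), integral_fun_fst (fun U => Φ U * conj (Φ (configReflect i c U))),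
    integral_const] at key
  simp only [probReal_univ, one_smul, Complex.one_re, mul_one] at key
  have e1 : (∫ U, Φ U ∂μ) = ((∫ U, halfWeight ρ β i c A U ∂μ : ℝ) : ℂ) := by
    rw [hΦ]; exact integral_complex_ofReal
  have e2 : (∫ U, Φ U * conj (Φ (configReflect i c U)) ∂μ) =
      ((∫ U, halfWeight ρ β i c A U * halfWeight ρ β i c A (configReflect i c U) ∂μ : ℝ) : ℂ) := by
    rw [hΦ]; dsimp only
    simp_rw [Complex.conj_ofReal, ← Complex.ofReal_mul]
    exact integral_complex_ofReal
  rw [e1, e2, Complex.ofReal_re, Complex.ofReal_re] at key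
  exact key

/-- **The doubling inequality on the torus**: for a set `A` of upper plaquettes,
`(∫ ∏_{A} w)² ≤ ∫ ∏_{A ∪ θ(A ∖ faces)} w` (product Haar measure, `β ≥ 0`). -/
theorem sq_integral_prod_tw_le (hρ : Continuous ρ) (hρN : ∀ g, (ρ g).trace.re ≤ N) (hβ : 0 ≤ β)
    {i : Fin d} {c : ZMod L} {H : ℕ} (hH : 2 * H < L) {A : Finset (Plaquette d L)}
    (hA : ∀ p ∈ A, IsUpper i c H p) :
    (∫ U, ∏ p ∈ A, tw ρ β p U ∂(Measure.pi fun _ : Edge d L => haarProbability G)) ^ 2 ≤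
      ∫ U, ∏ p ∈ A ∪ (A.filter fun p => ¬ IsFace i c p).image (plaqReflect i c), tw ρ β p U
        ∂(Measure.pi fun _ : Edge d L => haarProbability G) := by
  have h1 : (∫ U, ∏ p ∈ A, tw ρ β p U ∂(Measure.pi fun _ : Edge d L => haarProbability G)) ≤
      ∫ U, halfWeight ρ β i c A U ∂(Measure.pi fun _ : Edge d L => haarProbability G) :=
    integral_mono ((continuous_prod_tw ρ β hρ A).integrable_of_hasCompactSupport (HasCompactSupport.of_compactSpace _))
      ((continuous_halfWeight ρ β hρ i c A).integrable_of_hasCompactSupport (HasCompactSupport.of_compactSpace _))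
      fun U => prod_tw_le_halfWeight ρ β hρN hβ i c A U
  have h0 : 0 ≤ ∫ U, ∏ p ∈ A, tw ρ β p U ∂(Measure.pi fun _ : Edge d L => haarProbability G) :=
    integral_nonneg fun U => prod_nonneg fun p _ => (tw_pos ρ β p U).le
  have h2 := sq_integral_halfWeight_le ρ β hρ hρN hβ hH hA
  simp_rw [halfWeight_mul_halfWeight_configReflect ρ β hρ hH hA] at h2
  calc (∫ U, ∏ p ∈ A, tw ρ β p U ∂(Measure.pi fun _ : Edge d L => haarProbability G)) ^ 2
      ≤ (∫ U, halfWeight ρ β i c A U ∂(Measure.pi fun _ : Edge d L => haarProbability G)) ^ 2 :=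
        pow_le_pow_left₀ h0 h1 2
    _ ≤ _ := h2

end TorusDoubling

end

end Summit.QuantumFields.YangMills.Cruxes.IR.RPDoubling
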